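import Mathlib
import Summits.NavierStokesRegularity.NavierStokesRegularity.Theorems.EulerZoomLiouvillePowerGaugeEulerLiouvilleWeakConfinedVorticityTools
import Summits.NavierStokesRegularity.NavierStokesRegularity.Theorems.EulerZoomLiouvillePowerGaugeEulerLiouvilleCompactVortexBiotSavart
import Summits.NavierStokesRegularity.NavierStokesRegularity.Theorems.EulerZoomLiouvillePowerGaugeEulerLiouvilleSelfSimilarLpProfile
import HarnessLib

/-!
# Crux `EulerZoomLiouville.PowerGaugeEulerLiouville` (stmt-NavierStokesRegularity-19832), weak stratum `stub_selfSimilarWeakRest`: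
# EXACTLY SELF-SIMILAR MEMBERS OF ANY REGULARITY WHOSE VORTICITY IS CONFINED TO A BALL ARE TRIVIAL (`0 < ρ < ½`)

Route №10 `EulerZoomLiouville` (NavierStokesRegularity), crux E = stmt-NavierStokesRegularity-19832; width seat ns-ezl-w1 g8 under the
LEAD ns-typeII-p2 g14 — the answer to the LEAD's question (2026-08-29T01:46:37Z) «which SUB-CLASS of `Sig.stub_selfSimilarWeakRest` can be
closed FIRST as a MEMBER».  The sub-class: WEAK CONFINED VORTICITY — the profile `V` (no regularity beyond the class: `V ∈ W^{1,2}_loc`) has a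
whole-space weak gradient `G` that is a.e. SYMMETRIC on `{‖y‖ > R₀}` (`curl V = 0` weakly outside the ball `B̄(0,R₀)`; in physical variables the
vorticity of `u(τ)` is confined to the collapsing ball `‖x‖ ≤ R₀(−τ)^γ`).  This is the weak twin of the `C²` stratum
`Loc.selfSimilar_ae_eq_zero_of_compactCurlC2_profile` (Chae–Shvydkoy 2013 Thm 4.1's endgame) and of the classical Biot–Savart line V1
(`CompactVortex.slice_eq_biotSavart_curl`); it needs neither a flow nor the profile equation beyond what the class supplies.

Mechanism (Friedrichs regularisation + the tree's Biot–Savart representation, tools in `…WeakConfinedVorticityTools`):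
1. the class gives `V` a.e.-measurable, weakly divergence free, with the `A`-gauge growth `∫_{B_L}|V|² ≤ C L^{1−2ρ}` (`Past.profileData_of_past`);
2. every mollification `V_φ = φ ⋆ V` (`r_φ ≤ 1`) is smooth, divergence free, with `curl V_φ` supported in `B̄(0,R₀+1)` and the same growth, hence
   IS ITS BIOT–SAVART FIELD, `V_φ = K₃ ∗ curl V_φ` (`CompactVortex.eq_biotSavart_curl_of_growth`, `mollify_eq_biotSavart_curl`);
3. the `L¹` far field `‖K₃ ∗ ω(x)‖ ≤ ‖ω‖₁/(π‖x‖²)` with `‖curl V_φ‖₁ ≤ K := ∫_{B̄(0,R₀)}‖curlCLM ∘ G‖` UNIFORMLY in `φ` gives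
   `‖V_φ(x)‖ ≤ K/(π‖x‖²)` for `‖x‖ ≥ 2(R₀+1)` (`norm_mollify_le_of_le_norm`);
4. mollifications converge a.e. (`ae_tendsto_normed_convolution`), so `‖V(x)‖ ≤ K/(π‖x‖²)` a.e. on `{‖x‖ ≥ 2(R₀+1)}` (`ae_norm_le_of_confinedCurl`)
   and `V ∈ L²({‖x‖ ≥ 2(R₀+1)})` (`memLp_two_exterior_of_confinedCurl`);
5. the `L^p`-profile stratum at `q = 2 ≤ 3/(1+ρ)` (`LpProfile.selfSimilar_ae_eq_zero_of_memLp_profile[_past]`, the easy side of Chae–Shvydkoy's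
   window: sub-extremal ⇒ trivial) kills the member — `selfSimilar_ae_eq_zero_of_confinedCurl_profile` (origin-centred, binder shape of the
   skeleton's `IsExactlySelfSimilar`) and `…_past` (exactly self-similar about any `(T,x₀)` on a past sub-slab).

Binder proposed to the LEAD for a filled stub `stub_selfSimilarWeakConfinedVorticity` (and `¬(…)` added to `Sig.stub_selfSimilarWeakRest` for `ρ < ½`):
`∃ (G : E3 → E3 →L[ℝ] E3) (R₀ : ℝ), Literature.Analysis.FunctionSpaces.HasWeakFDerivOn ⊤ volume V G ∧
  ∀ᵐ y ∂volume, R₀ < ‖y‖ → ∀ v w : E3, inner ℝ (G y v) w = inner ℝ (G y w) v`.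
`ρ = ½` is NOT covered: there `V = O(‖y‖⁻²) ∈ L²` is consistent with extremality (energy-conserving exponent; the power-spread clause of
`IsPowerSpreadProfile` is not automatic).
WHAT THIS IS NOT: not NS, not E, not the weak stub — one weak sub-stratum member `--supports` stmt-19832; 19832 is OPEN.
[folklore; ChaeShvydkoy2013 §4 Thm 4.1 (endgame) with §3.2 Thm 3.2 (range α ≤ N/p); MajdaBertozziCUP2002 §2.4.1 Prop. 2.16; Evans2010 §5.3.1 Thm. 1]
-/

noncomputable section

-- flat `Theorems/<Route><Decl>…` files of one crux share the namespace of the crux (tree convention)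
set_option linter.dupNamespace false

open MeasureTheory Set Filter Topology Metric Function TopologicalSpace ContinuousLinearMap
open scoped ENNReal NNReal Convolution InnerProductSpace RealInnerProductSpace ContDiff

namespace Summit.NavierStokesRegularity.NavierStokesRegularity.Theorems.PowerGaugeEulerLiouville.WeakConfinedVorticity

open Literature.Analysis Literature.Analysis.FunctionSpaces Literature.Analysis.FluidPDE
open Summit.NavierStokesRegularity.NavierStokesRegularity.Theorems.PowerGaugeEulerLiouville

section Decay

variable {V : EuclideanSpace ℝ (Fin 3) → EuclideanSpace ℝ (Fin 3)}
  {G : EuclideanSpace ℝ (Fin 3) → EuclideanSpace ℝ (Fin 3) →L[ℝ] EuclideanSpace ℝ (Fin 3)}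

/-- **A mollified weak profile with confined vorticity and sub-volume growth IS ITS BIOT–SAVART FIELD.**  `V` with whole-space weak
gradient `G`, weakly divergence free, `G` a.e. symmetric on `{‖y‖ > R₀}`, growth `∫_{B_L}‖V‖² ≤ C L^θ` for `L ≥ L₀` (`C < ∞`, `θ < 3`);
`φ` a bump with `r_φ ≤ 1`.  Then `φ ⋆ V = K₃ ∗ curl (φ ⋆ V)` (tree `CompactVortex.eq_biotSavart_curl_of_growth` applied to the smooth,
divergence-free mollification, whose curl is compactly supported and whose growth is `≤ C 2^θ L^θ` for `L ≥ max L₀ 1`).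
[folklore; MajdaBertozziCUP2002 §2.4.1 Prop. 2.16] -/
theorem mollify_eq_biotSavart_curl (hw : HasWeakFDerivOn (⊤ : Opens (EuclideanSpace ℝ (Fin 3))) volume V G)
    (hdiv : IsWeaklyDivFree V) {R₀ : ℝ}
    (hsymm : ∀ᵐ y ∂(volume : Measure (EuclideanSpace ℝ (Fin 3))), R₀ < ‖y‖ →
      ∀ v w : EuclideanSpace ℝ (Fin 3), ⟪G y v, w⟫ = ⟪G y w, v⟫)
    (hVm : AEStronglyMeasurable V volume) {C : ℝ≥0∞} (hC : C ≠ ⊤) {θ L₀ : ℝ} (hθ : θ < 3)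
    (hA : ∀ L : ℝ, L₀ ≤ L → ∫⁻ y in ball (0 : EuclideanSpace ℝ (Fin 3)) L, ‖V y‖ₑ ^ 2 ≤ C * ENNReal.ofReal (L ^ θ))
    (φ : ContDiffBump (0 : EuclideanSpace ℝ (Fin 3))) (hφ : φ.rOut ≤ 1) :
    φ.normed volume ⋆[lsmul ℝ ℝ, volume] V = biotSavart (curl (φ.normed volume ⋆[lsmul ℝ ℝ, volume] V)) := by
  refine CompactVortex.eq_biotSavart_curl_of_growth (contDiff_mollify hw φ) (isDivFree_mollify hw hdiv φ)
    (hasCompactSupport_curl_mollify hw hsymm φ) (C := C * ENNReal.ofReal (2 ^ θ))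
    (ENNReal.mul_ne_top hC ENNReal.ofReal_ne_top) (θ := θ) (L₀ := max L₀ 1) hθ fun L hL => ?_
  have hL1 : 1 ≤ L := le_trans (le_max_right _ _) hL
  have hL0 : L₀ ≤ L := le_trans (le_max_left _ _) hL
  have hsub : ball (0 : EuclideanSpace ℝ (Fin 3)) (L + φ.rOut) ⊆ ball 0 (2 * L) :=
    ball_subset_ball (by linarith)
  calc ∫⁻ y in ball (0 : EuclideanSpace ℝ (Fin 3)) L, ‖(φ.normed volume ⋆[lsmul ℝ ℝ, volume] V) y‖ₑ ^ 2
      ≤ ∫⁻ y in ball (0 : EuclideanSpace ℝ (Fin 3)) (L + φ.rOut), ‖V y‖ₑ ^ 2 := lintegral_ball_mollify_sq_le hVm φ L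
    _ ≤ ∫⁻ y in ball (0 : EuclideanSpace ℝ (Fin 3)) (2 * L), ‖V y‖ₑ ^ 2 := lintegral_mono_set hsub
    _ ≤ C * ENNReal.ofReal ((2 * L) ^ θ) := hA (2 * L) (by linarith)
    _ = C * ENNReal.ofReal (2 ^ θ) * ENNReal.ofReal (L ^ θ) := by
        rw [Real.mul_rpow zero_le_two (by linarith), ENNReal.ofReal_mul (by positivity), mul_assoc]

/-- **Uniform far-field bound for the mollifications**: under the hypotheses of `mollify_eq_biotSavart_curl` with `0 ≤ R₀`, for every bump
with `r_φ ≤ 1` and every `‖x‖ ≥ 2(R₀+1)`, `‖(φ ⋆ V)(x)‖ ≤ π⁻¹ (‖x‖²)⁻¹ ∫_{B̄(0,R₀)}‖curlCLM ∘ G‖` — independent of `φ`. [folklore] -/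
theorem norm_mollify_le_of_le_norm (hw : HasWeakFDerivOn (⊤ : Opens (EuclideanSpace ℝ (Fin 3))) volume V G)
    (hdiv : IsWeaklyDivFree V) {R₀ : ℝ} (hR₀ : 0 ≤ R₀)
    (hsymm : ∀ᵐ y ∂(volume : Measure (EuclideanSpace ℝ (Fin 3))), R₀ < ‖y‖ →
      ∀ v w : EuclideanSpace ℝ (Fin 3), ⟪G y v, w⟫ = ⟪G y w, v⟫)
    (hVm : AEStronglyMeasurable V volume) {C : ℝ≥0∞} (hC : C ≠ ⊤) {θ L₀ : ℝ} (hθ : θ < 3)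
    (hA : ∀ L : ℝ, L₀ ≤ L → ∫⁻ y in ball (0 : EuclideanSpace ℝ (Fin 3)) L, ‖V y‖ₑ ^ 2 ≤ C * ENNReal.ofReal (L ^ θ))
    (φ : ContDiffBump (0 : EuclideanSpace ℝ (Fin 3))) (hφ : φ.rOut ≤ 1)
    {x : EuclideanSpace ℝ (Fin 3)} (hx : 2 * (R₀ + 1) ≤ ‖x‖) :
    ‖(φ.normed volume ⋆[lsmul ℝ ℝ, volume] V) x‖ ≤
      Real.pi⁻¹ * (‖x‖ ^ 2)⁻¹ * ∫ y, ‖(closedBall (0 : EuclideanSpace ℝ (Fin 3)) R₀).indicator (fun y => curlCLM (G y)) y‖ := by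
  have hrep := mollify_eq_biotSavart_curl hw hdiv hsymm hVm hC hθ hA φ hφ
  obtain ⟨hint, hL1⟩ := integral_norm_curl_mollify_le hw hsymm φ
  have hsupp : support (curl (φ.normed volume ⋆[lsmul ℝ ℝ, volume] V)) ⊆ closedBall (0 : EuclideanSpace ℝ (Fin 3)) (R₀ + 1) :=
    (support_curl_mollify_subset hw hsymm φ).trans (closedBall_subset_closedBall (by linarith))
  have hx' : 2 * (R₀ + 1) ≤ ‖x - 0‖ := by rwa [sub_zero]
  have hfar := norm_biotSavart_le_integral_norm_of_le_dist (x₀ := 0) (R := R₀ + 1) (by linarith) hint hsupp hx'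
  rw [sub_zero] at hfar
  rw [hrep]
  calc ‖biotSavart (curl (φ.normed volume ⋆[lsmul ℝ ℝ, volume] V)) x‖
      ≤ Real.pi⁻¹ * (‖x‖ ^ 2)⁻¹ * ∫ y, ‖curl (φ.normed volume ⋆[lsmul ℝ ℝ, volume] V) y‖ := hfar
    _ ≤ Real.pi⁻¹ * (‖x‖ ^ 2)⁻¹ *
          ∫ y, ‖(closedBall (0 : EuclideanSpace ℝ (Fin 3)) R₀).indicator (fun y => curlCLM (G y)) y‖ :=
        mul_le_mul_of_nonneg_left hL1 (by positivity)

/-- **POINTWISE DECAY OF A WEAK PROFILE WITH CONFINED VORTICITY**: `V ∈ L¹_loc` with whole-space weak gradient `G`, weakly divergence free,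
`G` a.e. symmetric on `{‖y‖ > R₀}` (`R₀ ≥ 0`), growth `∫_{B_L}‖V‖² ≤ C L^θ` (`L ≥ L₀`, `C < ∞`, `θ < 3`).  Then for a.e. `x` with
`‖x‖ ≥ 2(R₀+1)`: `‖V(x)‖ ≤ π⁻¹ K (‖x‖²)⁻¹`, `K = ∫_{B̄(0,R₀)}‖curlCLM ∘ G‖` (the uniform bound for the mollifications passes to the a.e. limit,
tree `FunctionSpaces.ae_tendsto_normed_convolution`).  This is the weak-class version of the `|y|⁻²` far field of a compactly supported vortex.
[folklore; MajdaBertozziCUP2002 §2.4.1 (K₃ homogeneous of degree −2)] -/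
theorem ae_norm_le_of_confinedCurl (hw : HasWeakFDerivOn (⊤ : Opens (EuclideanSpace ℝ (Fin 3))) volume V G)
    (hdiv : IsWeaklyDivFree V) {R₀ : ℝ} (hR₀ : 0 ≤ R₀)
    (hsymm : ∀ᵐ y ∂(volume : Measure (EuclideanSpace ℝ (Fin 3))), R₀ < ‖y‖ →
      ∀ v w : EuclideanSpace ℝ (Fin 3), ⟪G y v, w⟫ = ⟪G y w, v⟫)
    (hVm : AEStronglyMeasurable V volume) {C : ℝ≥0∞} (hC : C ≠ ⊤) {θ L₀ : ℝ} (hθ : θ < 3)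
    (hA : ∀ L : ℝ, L₀ ≤ L → ∫⁻ y in ball (0 : EuclideanSpace ℝ (Fin 3)) L, ‖V y‖ₑ ^ 2 ≤ C * ENNReal.ofReal (L ^ θ)) :
    ∀ᵐ x ∂(volume : Measure (EuclideanSpace ℝ (Fin 3))), 2 * (R₀ + 1) ≤ ‖x‖ →
      ‖V x‖ ≤ Real.pi⁻¹ * (‖x‖ ^ 2)⁻¹ *
        ∫ y, ‖(closedBall (0 : EuclideanSpace ℝ (Fin 3)) R₀).indicator (fun y => curlCLM (G y)) y‖ := by
  have hVl : LocallyIntegrable V volume := locallyIntegrableOn_univ.1 (by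
    simpa only [Opens.coe_top] using hw.locallyIntegrableOn)
  obtain ⟨φ, hφ0, hφ2⟩ := exists_contDiffBump_seq (E := EuclideanSpace ℝ (Fin 3))
  have hsmall : ∀ᶠ n in atTop, (φ n).rOut ≤ 1 :=
    (hφ0.eventually (gt_mem_nhds one_pos)).mono fun n hn => hn.le
  filter_upwards [ae_tendsto_normed_convolution hφ0 hφ2 hVl] with x hx hfar
  refine le_of_tendsto hx.norm ?_
  filter_upwards [hsmall] with n hn
  exact norm_mollify_le_of_le_norm hw hdiv hR₀ hsymm hVm hC hθ hA (φ n) hn hfar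

/-- **`V ∈ L²` NEAR INFINITY**: under the hypotheses of `ae_norm_le_of_confinedCurl`, `V ∈ L²({‖y‖ ≥ 2(R₀+1)})` (domination by
`4K π⁻¹ (1+‖y‖)⁻²`, square-integrable on `ℝ³`, Mathlib `integrable_one_add_norm`). [folklore] -/
theorem memLp_two_exterior_of_confinedCurl (hw : HasWeakFDerivOn (⊤ : Opens (EuclideanSpace ℝ (Fin 3))) volume V G)
    (hdiv : IsWeaklyDivFree V) {R₀ : ℝ} (hR₀ : 0 ≤ R₀)
    (hsymm : ∀ᵐ y ∂(volume : Measure (EuclideanSpace ℝ (Fin 3))), R₀ < ‖y‖ →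
      ∀ v w : EuclideanSpace ℝ (Fin 3), ⟪G y v, w⟫ = ⟪G y w, v⟫)
    (hVm : AEStronglyMeasurable V volume) {C : ℝ≥0∞} (hC : C ≠ ⊤) {θ L₀ : ℝ} (hθ : θ < 3)
    (hA : ∀ L : ℝ, L₀ ≤ L → ∫⁻ y in ball (0 : EuclideanSpace ℝ (Fin 3)) L, ‖V y‖ₑ ^ 2 ≤ C * ENNReal.ofReal (L ^ θ)) :
    MemLp V 2 (volume.restrict {y : EuclideanSpace ℝ (Fin 3) | 2 * (R₀ + 1) ≤ ‖y‖}) := by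
  obtain ⟨K, hK⟩ : ∃ K : ℝ,
      (∫ y, ‖(closedBall (0 : EuclideanSpace ℝ (Fin 3)) R₀).indicator (fun y => curlCLM (G y)) y‖) = K := ⟨_, rfl⟩
  have hK0 : 0 ≤ K := by
    rw [← hK]
    exact integral_nonneg fun _ => norm_nonneg _
  have hSm : MeasurableSet {y : EuclideanSpace ℝ (Fin 3) | 2 * (R₀ + 1) ≤ ‖y‖} :=
    measurableSet_le measurable_const measurable_norm
  -- the dominating function `g(y) = 4 π⁻¹ K (1+‖y‖)^{-2}` is in `L²(ℝ³)`
  have hgc : Continuous fun y : EuclideanSpace ℝ (Fin 3) => 4 * Real.pi⁻¹ * K * (1 + ‖y‖) ^ (-(2 : ℝ)) := by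
    refine continuous_const.mul (Continuous.rpow_const (continuous_const.add continuous_norm) fun y => Or.inl ?_)
    positivity
  have hg2 : MemLp (fun y : EuclideanSpace ℝ (Fin 3) => 4 * Real.pi⁻¹ * K * (1 + ‖y‖) ^ (-(2 : ℝ))) 2 volume := by
    rw [memLp_two_iff_integrable_sq hgc.aestronglyMeasurable]
    have hI := (integrable_one_add_norm (E := EuclideanSpace ℝ (Fin 3)) (μ := volume) (r := 4)
      (by rw [finrank_euclideanSpace_fin]; norm_num)).const_mul ((4 * Real.pi⁻¹ * K) ^ 2)
    refine hI.congr (Eventually.of_forall fun y => ?_)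
    have h1 : 0 < 1 + ‖y‖ := by positivity
    have h2 : ((1 + ‖y‖) ^ (-(2 : ℝ))) ^ 2 = (1 + ‖y‖) ^ (-(4 : ℝ)) := by
      rw [← Real.rpow_natCast ((1 + ‖y‖) ^ (-(2 : ℝ))) 2, ← Real.rpow_mul h1.le]
      norm_num
    change (4 * Real.pi⁻¹ * K) ^ 2 * (1 + ‖y‖) ^ (-(4 : ℝ)) = (4 * Real.pi⁻¹ * K * (1 + ‖y‖) ^ (-(2 : ℝ))) ^ 2
    rw [← h2]
    ring
  have key : ∀ᵐ y ∂(volume : Measure (EuclideanSpace ℝ (Fin 3))), y ∈ {y : EuclideanSpace ℝ (Fin 3) | 2 * (R₀ + 1) ≤ ‖y‖} →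
      ‖V y‖ ≤ ‖4 * Real.pi⁻¹ * K * (1 + ‖y‖) ^ (-(2 : ℝ))‖ := by
    filter_upwards [ae_norm_le_of_confinedCurl hw hdiv hR₀ hsymm hVm hC hθ hA] with y hy hyS
    have hy2 : 2 * (R₀ + 1) ≤ ‖y‖ := hyS
    have hy1 : 1 ≤ ‖y‖ := by linarith
    have hb := hy hy2
    rw [hK] at hb
    have h1 : 0 < 1 + ‖y‖ := by positivity
    have hpow : 0 ≤ (1 + ‖y‖) ^ (-(2 : ℝ)) := Real.rpow_nonneg h1.le _
    have hgy : 0 ≤ 4 * Real.pi⁻¹ * K * (1 + ‖y‖) ^ (-(2 : ℝ)) :=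
      mul_nonneg (mul_nonneg (by positivity) hK0) hpow
    rw [Real.norm_of_nonneg hgy]
    -- `(‖y‖²)⁻¹ ≤ 4 (1+‖y‖)^{-2}`
    have hcmp : (‖y‖ ^ 2)⁻¹ ≤ 4 * (1 + ‖y‖) ^ (-(2 : ℝ)) := by
      rw [Real.rpow_neg h1.le, show (2 : ℝ) = ((2 : ℕ) : ℝ) by norm_num, Real.rpow_natCast]
      rw [show (4 : ℝ) * ((1 + ‖y‖) ^ 2)⁻¹ = ((1 + ‖y‖) ^ 2 / 4)⁻¹ by rw [inv_div]; ring]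
      refine inv_anti₀ (by positivity) ?_
      nlinarith
    calc ‖V y‖ ≤ Real.pi⁻¹ * (‖y‖ ^ 2)⁻¹ * K := hb
      _ ≤ Real.pi⁻¹ * (4 * (1 + ‖y‖) ^ (-(2 : ℝ))) * K := by gcongr
      _ = 4 * Real.pi⁻¹ * K * (1 + ‖y‖) ^ (-(2 : ℝ)) := by ring
  exact (hg2.restrict _).of_le hVm.restrict ((ae_restrict_iff' hSm).2 key)

end Decay

/-! ### Member level -/

section Member

/-- **WEAK CONFINED VORTICITY, ORIGIN-CENTRED MEMBER** (crux hypotheses verbatim, binder shape of the skeleton's `IsExactlySelfSimilar`;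
`0 < ρ < ½`): an exactly self-similar member of Seregin's power-gauged ancient Euler class whose velocity profile `V` — of ANY regularity —
has a whole-space weak gradient `G` that is a.e. symmetric outside some ball (`curl V = 0` weakly on `{‖y‖ > R₀}`: vorticity confined to
`B̄(0,R₀)`) is trivial.  Chain: `Past.profileData_of_past` (measurability, weak incompressibility, `A`-growth) ⇒ `memLp_two_exterior_of_confinedCurl`
⇒ `LpProfile.selfSimilar_ae_eq_zero_of_memLp_profile` at `q = 2 ≤ 3/(1+ρ)`. [folklore; ChaeShvydkoy2013 §4 Thm 4.1 with §3.2 Thm 3.2] -/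
theorem selfSimilar_ae_eq_zero_of_confinedCurl_profile {ρ : ℝ} (hρ : 0 < ρ) (hρ2 : ρ < 1 / 2)
    {u : ℝ → EuclideanSpace ℝ (Fin 3) → EuclideanSpace ℝ (Fin 3)} {p : ℝ → EuclideanSpace ℝ (Fin 3) → ℝ}
    {H : ℝ → EuclideanSpace ℝ (Fin 3) → EuclideanSpace ℝ (Fin 3) →L[ℝ] EuclideanSpace ℝ (Fin 3)} {c : ℝ≥0}
    (hsw : IsSuitableWeakSolutionOn (slab (EuclideanSpace ℝ (Fin 3)) (Iio 0) isOpen_Iio) 0 0 u p)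
    (hH : HasWeakSpatialGradientOn (slab (EuclideanSpace ℝ (Fin 3)) (Iio 0) isOpen_Iio) u H)
    (hgauge : ∀ a : ℝ, 0 < a →
      ENNReal.ofReal (a ^ (2 * ρ)) * cknA a (0 : ℝ × EuclideanSpace ℝ (Fin 3)) u +
          ENNReal.ofReal (a ^ ρ) * cknE a (0 : ℝ × EuclideanSpace ℝ (Fin 3)) H +
        ENNReal.ofReal (a ^ (2 * ρ)) * cknD a (0 : ℝ × EuclideanSpace ℝ (Fin 3)) p ≤ (c : ℝ≥0∞))
    {V : EuclideanSpace ℝ (Fin 3) → EuclideanSpace ℝ (Fin 3)} {P : EuclideanSpace ℝ (Fin 3) → ℝ}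
    (hu : ∀ τ : ℝ, τ < 0 → u τ = selfSimilarCollapse (1 / (2 + ρ)) 0 V τ)
    (hp : ∀ τ : ℝ, τ < 0 → p τ = selfSimilarCollapsePressure (1 / (2 + ρ)) 0 P τ)
    {G : EuclideanSpace ℝ (Fin 3) → EuclideanSpace ℝ (Fin 3) →L[ℝ] EuclideanSpace ℝ (Fin 3)} {R₀ : ℝ}
    (hVG : HasWeakFDerivOn (⊤ : Opens (EuclideanSpace ℝ (Fin 3))) volume V G)
    (hsymm : ∀ᵐ y ∂(volume : Measure (EuclideanSpace ℝ (Fin 3))), R₀ < ‖y‖ →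
      ∀ v w : EuclideanSpace ℝ (Fin 3), ⟪G y v, w⟫ = ⟪G y w, v⟫) :
    uncurry u =ᵐ[volume.restrict (Iio (0 : ℝ) ×ˢ (univ : Set (EuclideanSpace ℝ (Fin 3))))] 0 := by
  have hA : ∀ a : ℝ, 0 < a → ENNReal.ofReal (a ^ (2 * ρ)) *
      cknA a (0 : ℝ × EuclideanSpace ℝ (Fin 3)) u ≤ (c : ℝ≥0∞) :=
    fun a ha => le_trans (le_trans le_self_add le_self_add) (hgauge a ha)
  have hE : ∀ a : ℝ, 0 < a → ENNReal.ofReal (a ^ ρ) *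
      cknE a (0 : ℝ × EuclideanSpace ℝ (Fin 3)) H ≤ (c : ℝ≥0∞) :=
    fun a ha => le_trans (le_trans le_add_self le_self_add) (hgauge a ha)
  have hD : ∀ a : ℝ, 0 < a → ENNReal.ofReal (a ^ (2 * ρ)) *
      cknD a (0 : ℝ × EuclideanSpace ℝ (Fin 3)) p ≤ (c : ℝ≥0∞) :=
    fun a ha => le_trans le_add_self (hgauge a ha)
  have hu' : ∀ τ : ℝ, τ < 0 → u τ = fun x => selfSimilarCollapse (1 / (2 + ρ)) 0 V τ (x - 0) :=
    fun τ hτ => by rw [hu τ hτ]; funext x; rw [sub_zero]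
  have hp' : ∀ τ : ℝ, τ < 0 → p τ = fun x => selfSimilarCollapsePressure (1 / (2 + ρ)) 0 P τ (x - 0) :=
    fun τ hτ => by rw [hp τ hτ]; funext x; rw [sub_zero]
  obtain ⟨G', hVm, -, -, -, -, ⟨CA, hCA, hAgr⟩, -, -, -, -, -, hdivV, -, -, -⟩ :=
    Past.profileData_of_past hρ hρ2.le le_rfl le_rfl 0 hsw.distributional hH hA hE hD hu' hp'
  -- symmetric beyond `max R₀ 0` as well
  have hsymm' : ∀ᵐ y ∂(volume : Measure (EuclideanSpace ℝ (Fin 3))), max R₀ 0 < ‖y‖ →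
      ∀ v w : EuclideanSpace ℝ (Fin 3), ⟪G y v, w⟫ = ⟪G y w, v⟫ := by
    filter_upwards [hsymm] with y hy hR
    exact hy (lt_of_le_of_lt (le_max_left _ _) hR)
  have hmem := memLp_two_exterior_of_confinedCurl hVG hdivV (le_max_right R₀ 0) hsymm' hVm hCA
    (θ := 1 - 2 * ρ) (L₀ := 2 - 0) (by linarith) hAgr
  have hq : (2 : ℝ) ≤ 3 / (1 + ρ) := by
    rw [le_div_iff₀ (by linarith)]
    linarith
  have hmem' : MemLp V (ENNReal.ofReal 2) (volume.restrict {y : EuclideanSpace ℝ (Fin 3) | 2 * (max R₀ 0 + 1) ≤ ‖y‖}) := by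
    rwa [ENNReal.ofReal_ofNat]
  exact LpProfile.selfSimilar_ae_eq_zero_of_memLp_profile hρ hρ2 hsw hH hgauge hu hp le_rfl hq hmem'

/-- **WEAK CONFINED VORTICITY, PAST/SHIFTED MEMBER** (`0 < ρ < ½`): a member exactly self-similar about `(T, x₀)` for `τ < T₁` (`T₁ ≤ 0`, `T₁ ≤ T`;
arbitrary on `[T₁,0)`) whose velocity profile has a whole-space weak gradient a.e. symmetric outside a ball is trivial
(`Past.profileData_of_past` + `memLp_two_exterior_of_confinedCurl` + `LpProfile.selfSimilar_ae_eq_zero_of_memLp_profile_past`).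
[folklore; ChaeShvydkoy2013 §4 Thm 4.1 with §3.2 Thm 3.2] -/
theorem selfSimilar_ae_eq_zero_of_confinedCurl_profile_past {ρ : ℝ} (hρ : 0 < ρ) (hρ2 : ρ < 1 / 2)
    {T T₁ : ℝ} (hT₁ : T₁ ≤ 0) (hTT₁ : T₁ ≤ T) (x₀ : EuclideanSpace ℝ (Fin 3))
    {u : ℝ → EuclideanSpace ℝ (Fin 3) → EuclideanSpace ℝ (Fin 3)} {p : ℝ → EuclideanSpace ℝ (Fin 3) → ℝ}
    {H : ℝ → EuclideanSpace ℝ (Fin 3) → EuclideanSpace ℝ (Fin 3) →L[ℝ] EuclideanSpace ℝ (Fin 3)} {c : ℝ≥0}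
    (hsw : IsSuitableWeakSolutionOn (slab (EuclideanSpace ℝ (Fin 3)) (Iio 0) isOpen_Iio) 0 0 u p)
    (hH : HasWeakSpatialGradientOn (slab (EuclideanSpace ℝ (Fin 3)) (Iio 0) isOpen_Iio) u H)
    (hgauge : ∀ a : ℝ, 0 < a →
      ENNReal.ofReal (a ^ (2 * ρ)) * cknA a (0 : ℝ × EuclideanSpace ℝ (Fin 3)) u +
          ENNReal.ofReal (a ^ ρ) * cknE a (0 : ℝ × EuclideanSpace ℝ (Fin 3)) H +
        ENNReal.ofReal (a ^ (2 * ρ)) * cknD a (0 : ℝ × EuclideanSpace ℝ (Fin 3)) p ≤ (c : ℝ≥0∞))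
    {V : EuclideanSpace ℝ (Fin 3) → EuclideanSpace ℝ (Fin 3)} {P : EuclideanSpace ℝ (Fin 3) → ℝ}
    (hu : ∀ τ : ℝ, τ < T₁ → u τ = fun x => selfSimilarCollapse (1 / (2 + ρ)) T V τ (x - x₀))
    (hp : ∀ τ : ℝ, τ < T₁ → p τ = fun x => selfSimilarCollapsePressure (1 / (2 + ρ)) T P τ (x - x₀))
    {G : EuclideanSpace ℝ (Fin 3) → EuclideanSpace ℝ (Fin 3) →L[ℝ] EuclideanSpace ℝ (Fin 3)} {R₀ : ℝ}
    (hVG : HasWeakFDerivOn (⊤ : Opens (EuclideanSpace ℝ (Fin 3))) volume V G)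
    (hsymm : ∀ᵐ y ∂(volume : Measure (EuclideanSpace ℝ (Fin 3))), R₀ < ‖y‖ →
      ∀ v w : EuclideanSpace ℝ (Fin 3), ⟪G y v, w⟫ = ⟪G y w, v⟫) :
    uncurry u =ᵐ[volume.restrict (Iio (0 : ℝ) ×ˢ (univ : Set (EuclideanSpace ℝ (Fin 3))))] 0 := by
  have hA : ∀ a : ℝ, 0 < a → ENNReal.ofReal (a ^ (2 * ρ)) *
      cknA a (0 : ℝ × EuclideanSpace ℝ (Fin 3)) u ≤ (c : ℝ≥0∞) :=
    fun a ha => le_trans (le_trans le_self_add le_self_add) (hgauge a ha)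
  have hE : ∀ a : ℝ, 0 < a → ENNReal.ofReal (a ^ ρ) *
      cknE a (0 : ℝ × EuclideanSpace ℝ (Fin 3)) H ≤ (c : ℝ≥0∞) :=
    fun a ha => le_trans (le_trans le_add_self le_self_add) (hgauge a ha)
  have hD : ∀ a : ℝ, 0 < a → ENNReal.ofReal (a ^ (2 * ρ)) *
      cknD a (0 : ℝ × EuclideanSpace ℝ (Fin 3)) p ≤ (c : ℝ≥0∞) :=
    fun a ha => le_trans le_add_self (hgauge a ha)
  obtain ⟨G', hVm, -, -, -, -, ⟨CA, hCA, hAgr⟩, -, -, -, -, -, hdivV, -, -, -⟩ :=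
    Past.profileData_of_past hρ hρ2.le hT₁ hTT₁ x₀ hsw.distributional hH hA hE hD hu hp
  have hsymm' : ∀ᵐ y ∂(volume : Measure (EuclideanSpace ℝ (Fin 3))), max R₀ 0 < ‖y‖ →
      ∀ v w : EuclideanSpace ℝ (Fin 3), ⟪G y v, w⟫ = ⟪G y w, v⟫ := by
    filter_upwards [hsymm] with y hy hR
    exact hy (lt_of_le_of_lt (le_max_left _ _) hR)
  have hmem := memLp_two_exterior_of_confinedCurl hVG hdivV (le_max_right R₀ 0) hsymm' hVm hCA
    (θ := 1 - 2 * ρ) (L₀ := 2 - T₁) (by linarith) hAgr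
  have hq : (2 : ℝ) ≤ 3 / (1 + ρ) := by
    rw [le_div_iff₀ (by linarith)]
    linarith
  have hmem' : MemLp V (ENNReal.ofReal 2) (volume.restrict {y : EuclideanSpace ℝ (Fin 3) | 2 * (max R₀ 0 + 1) ≤ ‖y‖}) := by
    rwa [ENNReal.ofReal_ofNat]
  exact LpProfile.selfSimilar_ae_eq_zero_of_memLp_profile_past hρ hρ2 hT₁ hTT₁ x₀ hsw hH hgauge hu hp le_rfl hq hmem'

end Member

end Summit.NavierStokesRegularity.NavierStokesRegularity.Theorems.PowerGaugeEulerLiouville.WeakConfinedVorticity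

end
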